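import Mathlib
import HarnessLib
import Summits.Ventures.LatticeQCDFlow.Exactness.CircleDegreeOneJacobian

/-!
# Circular splines are certified circle maps: the degree-one extension of a `C¹` unit-interval profile with matching end slopes, and its exact Jacobian on `ℝ/2πℤ`

HONEST FRAMING: exact (Metropolis-corrected) sampling algorithms for lattice gauge theory;
figures of merit are autocorrelation/cost numbers at stated couplings and volumes; no
continuum-physics claim.

Venture `LatticeQCDFlow` (cell pub-lqcd), topic `Exactness`; FANOUT row 10 (`eng-equiv`, engine
`latflow.equiv`, module `equiv/splines.py`, functions `circ_spline_forward` /
`circ_spline_inverse`, release `equiv-0.4.1`; the same construction is the circular-spline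
coupling of `latflow.flows_jax`).  NEW WORK of the cell over Mathlib (`Int.fract`, one-sided
derivatives, `ContinuousOn.comp_fract''`) and the tree's
`Exactness/CircleDegreeOneJacobian.lean` (row 14: `hasJacobian_circle_of_degreeOne` — any `C¹`
degree-one lift with positive derivative is a U(1) link map with exact Jacobian).  Nothing is
cited as a fact; no number.  Printed counterparts, NAMED ONLY: Rezende et al. 2020 (circular
splines: a monotone spline of `[0,1]` with equal end slopes defines a circle diffeomorphism),
Durkan et al. 2019 (rational-quadratic splines), Kanwar et al. 2020 / Boyda et al. 2021.

## The object

The engine moves an angle by `θ' = wrap(2π·f(u) − π + σ_in + σ_out)` with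
`u = (wrap(θ − σ_in) + π)/(2π)`, which is `fract((θ + c)/(2π))`, `c = π − σ_in`, except at the
one angle where `wrap` returns `π` (there `u = 1` instead of `0`: the same point `θ'` and the same
slope, because `f 1 = f 0 + 1` and `f' 1 = f' 0`); here `f : [0,1] → [0,1]` is a monotone spline
with `f(0) = 0`, `f(1) = 1` and EQUAL END SLOPES `f'(0) = f'(1)` (the "circular" constraint
`d_0 = d_K` of `rqs_normalise(circular=True)`), and the engine books `log dθ'/dθ = log f'(u)` —
the spline's own log-derivative, no `2π` factors.  The lift of this
circle map to `ℝ` is the DEGREE-ONE EXTENSION `u ↦ f(fract u) + ⌊u⌋` of the profile, rescaled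
to period `2π`.  All statements are about explicit expressions (no definition is introduced); the
profile enters only through the hypotheses

  `hderiv : ∀ u ∈ [0,1], HasDerivWithinAt f (f' u) [0,1] u`, `hdeg : f 1 = f 0 + 1`,
  `hslope : f' 1 = f' 0` (and, for the certificate, `ContinuousOn f' [0,1]`, `0 < f'` on `[0,1]`),

so the file serves every circular spline family (rational-quadratic with any number of bins —
the per-bin `C¹` facts and the knot matching are `RationalQuadraticSpline.lean` — or any other).

## Content

* `unitExt_add_one` — degree one: `E(u + 1) = E(u) + 1` for `E u = f(fract u) + ⌊u⌋`;
* `hasDerivAt_unitExt_of_fract_ne_zero` — off the integers `E` is locally `f(· − n) + n`, so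
  `E' = f'(fract u)`; `hasDerivAt_unitExt_intCast` — AT an integer the right derivative is
  `f'(0)` and the left derivative is `f'(1)` (the left piece reaches the knot by `hdeg`), equal by
  `hslope`; **`hasDerivAt_unitExt`** — `E` is differentiable on all of `ℝ` with `E' = f' ∘ fract`;
  `continuous_unitExt_deriv` — `f' ∘ fract` is continuous (`ContinuousOn.comp_fract''`);
* the period-`2π` lift `Φ θ = 2π·E((θ + c)/(2π)) + c'`: `hasDerivAt_circSplineLift`
  (`Φ' θ = f'(fract((θ + c)/(2π)))`), `circSplineLift_add_two_pi`, `circSplineLift_coe` (on the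
  circle the `2π⌊·⌋` term drops: `↑(Φ θ) = ↑(2π f(fract((θ + c)/(2π))) + c')`);
* `exists_circle_circSpline` (non-vacuity: such `F`, `J` exist on `ℝ/2πℤ`) and
  **`hasJacobian_circle_circSpline`** — for any `F : ℝ/2πℤ → ℝ/2πℤ` and `J` with
  `F ↑θ = ↑(2π·f(fract((θ + c)/(2π))) + c')` and `J ↑θ = ofReal (f'(fract((θ + c)/(2π))))`:
  `HasJacobian volume F J`.  With `c = π − σ_in`, `c' = σ_in + σ_out − π` this is literally
  `circ_spline_forward` with its booked log-derivative: the circular spline coupling is exact on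
  the U(1) link, for the Haar measure, with the engine's Jacobian.

NOT here: the assembly of a `K`-bin rational-quadratic profile into one `f` on `[0,1]` (bin
lookup; its `C¹`-ness across interior knots is the same one-sided gluing as
`hasDerivAt_unitExt_intCast`, with `RationalQuadraticSpline.rqsBin_deriv_left/right` supplying the
matching slopes); coupling layers (`CircleDegreeOneJacobian.hasJacobian_coupleFun_of_degreeOne`
applies verbatim once the network's outputs are measurable); SU(N).
-/

noncomputable section

namespace Summit.Ventures.LatticeQCDFlow.Exactness

open Real Set Filter MeasureTheory Topology
open scoped ENNReal

/-! ## The degree-one extension `E u = f (fract u) + ⌊u⌋` of a unit-interval profile -/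

section UnitExtension

variable {f f' : ℝ → ℝ}

/-- **Degree one**: `E(u + 1) = E(u) + 1`. -/
theorem unitExt_add_one (f : ℝ → ℝ) (u : ℝ) :
    f (Int.fract (u + 1)) + ((⌊u + 1⌋ : ℤ) : ℝ) = (f (Int.fract u) + ((⌊u⌋ : ℤ) : ℝ)) + 1 := by
  rw [Int.fract_add_one, Int.floor_add_one]
  push_cast
  ring

/-- On the cell `[n, n+1)` the extension is the translate `f(· − n) + n`. -/
theorem unitExt_eq_of_mem_Ico {n : ℤ} {v : ℝ} (hv : v ∈ Ico (n : ℝ) (n + 1)) :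
    f (Int.fract v) + ((⌊v⌋ : ℤ) : ℝ) = f (v - n) + n := by
  have hfl : ⌊v⌋ = n := Int.floor_eq_iff.2 ⟨hv.1, hv.2⟩
  rw [Int.fract, hfl]

/-- **Off the integers** the extension has derivative `f'(fract u)` (the profile is differentiable
at the interior point `fract u ∈ (0,1)` and `⌊·⌋` is locally constant). -/
theorem hasDerivAt_unitExt_of_fract_ne_zero
    (hderiv : ∀ u ∈ Icc (0 : ℝ) 1, HasDerivWithinAt f (f' u) (Icc 0 1) u) {u : ℝ}
    (hu : Int.fract u ≠ 0) :
    HasDerivAt (fun v : ℝ => f (Int.fract v) + ((⌊v⌋ : ℤ) : ℝ)) (f' (Int.fract u)) u := by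
  set n : ℤ := ⌊u⌋ with hn
  have hpos : 0 < Int.fract u := lt_of_le_of_ne (Int.fract_nonneg u) (Ne.symm hu)
  have hlt1 : Int.fract u < 1 := Int.fract_lt_one u
  have h1 : (n : ℝ) < u := by
    have := Int.self_sub_floor u  -- fract u = u - ⌊u⌋
    rw [Int.fract] at hpos; linarith
  have h2 : u < n + 1 := by rw [hn]; exact Int.lt_floor_add_one u
  -- the profile at the interior point `fract u = u - n`
  have hf : HasDerivAt f (f' (Int.fract u)) (u - n) := by
    have h := (hderiv (Int.fract u) ⟨hpos.le, hlt1.le⟩).hasDerivAt (Icc_mem_nhds hpos hlt1)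
    rwa [Int.fract] at h ⊢
  have hg : HasDerivAt (fun v : ℝ => f (v - n) + (n : ℝ)) (f' (Int.fract u)) u :=
    (HasDerivAt.comp_sub_const u (n : ℝ) hf).add_const _
  refine hg.congr_of_eventuallyEq ?_
  filter_upwards [Ioo_mem_nhds h1 h2] with v hv
  exact unitExt_eq_of_mem_Ico ⟨hv.1.le, hv.2⟩

/-- **At an integer** `n`: the right derivative of the extension is `f'(0)` (piece
`f(· − n) + n` on `[n, n+1]`), the left derivative is `f'(1)` (piece `f(· − n + 1) + n − 1` on
`[n−1, n]`, which reaches the value `f(0) + n` at `n` because `f 1 = f 0 + 1`); with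
`f' 1 = f' 0` the extension is differentiable at `n` with derivative `f'(0)`. -/
theorem hasDerivAt_unitExt_intCast
    (hderiv : ∀ u ∈ Icc (0 : ℝ) 1, HasDerivWithinAt f (f' u) (Icc 0 1) u)
    (hdeg : f 1 = f 0 + 1) (hslope : f' 1 = f' 0) (n : ℤ) :
    HasDerivAt (fun v : ℝ => f (Int.fract v) + ((⌊v⌋ : ℤ) : ℝ)) (f' 0) (n : ℝ) := by
  have hn1 : (n : ℝ) < n + 1 := by linarith
  have hn0 : (n : ℝ) - 1 < n := by linarith
  -- RIGHT: the piece `f (v - n) + n` on `[n, n+1]`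
  have hR : HasDerivWithinAt (fun v : ℝ => f (Int.fract v) + ((⌊v⌋ : ℤ) : ℝ)) (f' 0)
      (Ici (n : ℝ)) n := by
    have h0 : HasDerivWithinAt f (f' 0) (Icc 0 1) 0 := hderiv 0 ⟨le_rfl, zero_le_one⟩
    have hsub : HasDerivWithinAt (fun v : ℝ => v - n) 1 (Icc (n : ℝ) (n + 1)) n :=
      ((hasDerivAt_id' (n : ℝ)).sub_const (n : ℝ)).hasDerivWithinAt
    have hmaps : MapsTo (fun v : ℝ => v - n) (Icc (n : ℝ) (n + 1)) (Icc 0 1) :=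
      fun v hv => ⟨by linarith [hv.1], by linarith [hv.2]⟩
    have hg : HasDerivWithinAt (fun v : ℝ => f (v - n) + (n : ℝ)) (f' 0 * 1)
        (Icc (n : ℝ) (n + 1)) n := (h0.comp_of_eq (n : ℝ) hsub hmaps (by simp)).add_const _
    rw [mul_one] at hg
    refine (hg.mono_of_mem_nhdsWithin (Icc_mem_nhdsGE hn1)).congr_of_eventuallyEq ?_ ?_
    · filter_upwards [Ico_mem_nhdsGE hn1] with v hv
      exact unitExt_eq_of_mem_Ico hv
    · exact unitExt_eq_of_mem_Ico ⟨le_rfl, hn1⟩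
  -- LEFT: the piece `f (v - (n - 1)) + (n - 1)` on `[n-1, n]`
  have hL : HasDerivWithinAt (fun v : ℝ => f (Int.fract v) + ((⌊v⌋ : ℤ) : ℝ)) (f' 0)
      (Iic (n : ℝ)) n := by
    have h1 : HasDerivWithinAt f (f' 1) (Icc 0 1) 1 := hderiv 1 ⟨zero_le_one, le_rfl⟩
    have hsub : HasDerivWithinAt (fun v : ℝ => v - (n - 1)) 1 (Icc ((n : ℝ) - 1) n) n :=
      ((hasDerivAt_id' (n : ℝ)).sub_const ((n : ℝ) - 1)).hasDerivWithinAt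
    have hmaps : MapsTo (fun v : ℝ => v - (n - 1)) (Icc ((n : ℝ) - 1) n) (Icc 0 1) :=
      fun v hv => ⟨by linarith [hv.1], by linarith [hv.2]⟩
    have hg : HasDerivWithinAt (fun v : ℝ => f (v - (n - 1)) + ((n : ℝ) - 1)) (f' 1 * 1)
        (Icc ((n : ℝ) - 1) n) n := (h1.comp_of_eq (n : ℝ) hsub hmaps (by simp)).add_const _
    rw [mul_one, hslope] at hg
    refine (hg.mono_of_mem_nhdsWithin (Icc_mem_nhdsLE hn0)).congr_of_eventuallyEq ?_ ?_
    · filter_upwards [Ioc_mem_nhdsLE hn0] with v hv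
      rcases hv.2.lt_or_eq with hlt | heq
      · -- `v ∈ (n-1, n)`: the cell of `n - 1`
        have hv' : v ∈ Ico (((n - 1 : ℤ) : ℝ)) ((n - 1 : ℤ) + 1) := by
          push_cast; exact ⟨hv.1.le, by linarith⟩
        rw [unitExt_eq_of_mem_Ico hv']
        push_cast
        ring_nf
      · -- `v = n`: the left piece reaches `f 0 + n` by `f 1 = f 0 + 1`
        subst heq
        rw [unitExt_eq_of_mem_Ico ⟨le_rfl, hn1⟩]
        have e1 : (n : ℝ) - (n - 1) = 1 := by ring
        rw [sub_self, e1, hdeg]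
        ring
    · rw [unitExt_eq_of_mem_Ico ⟨le_rfl, hn1⟩]
      have e1 : (n : ℝ) - (n - 1) = 1 := by ring
      rw [sub_self, e1, hdeg]
      ring
  have h := hL.union hR
  rw [Iic_union_Ici, hasDerivWithinAt_univ] at h
  exact h

/-- **The degree-one extension is differentiable everywhere**, with derivative `f' ∘ fract`. -/
theorem hasDerivAt_unitExt
    (hderiv : ∀ u ∈ Icc (0 : ℝ) 1, HasDerivWithinAt f (f' u) (Icc 0 1) u)
    (hdeg : f 1 = f 0 + 1) (hslope : f' 1 = f' 0) (u : ℝ) :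
    HasDerivAt (fun v : ℝ => f (Int.fract v) + ((⌊v⌋ : ℤ) : ℝ)) (f' (Int.fract u)) u := by
  by_cases hu : Int.fract u = 0
  · have e : u = ((⌊u⌋ : ℤ) : ℝ) := by
      have := Int.self_sub_floor u
      rw [Int.fract] at hu
      linarith
    rw [hu, e]
    exact hasDerivAt_unitExt_intCast hderiv hdeg hslope ⌊u⌋
  · exact hasDerivAt_unitExt_of_fract_ne_zero hderiv hu

/-- The derivative `f' ∘ fract` of the extension is continuous (`f'` continuous on `[0,1]` with
`f' 1 = f' 0`). -/
theorem continuous_unitExt_deriv (hcont : ContinuousOn f' (Icc 0 1)) (hslope : f' 1 = f' 0) :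
    Continuous fun v : ℝ => f' (Int.fract v) :=
  hcont.comp_fract'' hslope.symm

/-- The derivative of the extension is positive if `f' > 0` on `[0,1]`. -/
theorem unitExt_deriv_pos (hpos : ∀ u ∈ Icc (0 : ℝ) 1, 0 < f' u) (v : ℝ) :
    0 < f' (Int.fract v) :=
  hpos _ ⟨Int.fract_nonneg v, (Int.fract_lt_one v).le⟩

end UnitExtension

/-! ## The period-`2π` lift `Φ θ = 2π · E((θ + c)/(2π)) + c'` and the circle certificate -/

section Circle

variable {f f' : ℝ → ℝ}

/-- **Derivative of the lift**: `Φ' θ = f'(fract((θ + c)/(2π)))` — the `2π` of the rescaling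
cancels the `1/(2π)` of the inner map, which is why the engine books the spline's own
log-derivative. -/
theorem hasDerivAt_circSplineLift
    (hderiv : ∀ u ∈ Icc (0 : ℝ) 1, HasDerivWithinAt f (f' u) (Icc 0 1) u)
    (hdeg : f 1 = f 0 + 1) (hslope : f' 1 = f' 0) (c c' θ : ℝ) :
    HasDerivAt (fun t : ℝ => 2 * π * (f (Int.fract ((t + c) / (2 * π))) +
        ((⌊(t + c) / (2 * π)⌋ : ℤ) : ℝ)) + c')
      (f' (Int.fract ((θ + c) / (2 * π)))) θ := by
  have hin : HasDerivAt (fun t : ℝ => (t + c) / (2 * π)) (1 / (2 * π)) θ := by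
    simpa using ((hasDerivAt_id' θ).add_const c).div_const (2 * π)
  have hE := hasDerivAt_unitExt hderiv hdeg hslope ((θ + c) / (2 * π))
  refine (((hE.comp θ hin).const_mul (2 * π)).add_const c').congr_deriv ?_
  field_simp

/-- **Degree one of the lift**: `Φ(θ + 2π) = Φ(θ) + 2π`. -/
theorem circSplineLift_add_two_pi (f : ℝ → ℝ) (c c' θ : ℝ) :
    2 * π * (f (Int.fract ((θ + 2 * π + c) / (2 * π))) +
        ((⌊(θ + 2 * π + c) / (2 * π)⌋ : ℤ) : ℝ)) + c' =
      (2 * π * (f (Int.fract ((θ + c) / (2 * π))) + ((⌊(θ + c) / (2 * π)⌋ : ℤ) : ℝ)) + c') +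
        2 * π := by
  have hπ : (2 : ℝ) * π ≠ 0 := by positivity
  have e : (θ + 2 * π + c) / (2 * π) = (θ + c) / (2 * π) + 1 := by
    field_simp
    ring
  rw [e, unitExt_add_one]
  ring

/-- **On the circle the `2π⌊·⌋` term drops**: `↑(Φ θ) = ↑(2π·f(fract((θ + c)/(2π))) + c')` in
`ℝ/2πℤ`. -/
theorem circSplineLift_coe (f : ℝ → ℝ) (c c' θ : ℝ) :
    (((2 * π * (f (Int.fract ((θ + c) / (2 * π))) + ((⌊(θ + c) / (2 * π)⌋ : ℤ) : ℝ)) + c' : ℝ)) :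
        AddCircle (2 * π)) =
      (((2 * π * f (Int.fract ((θ + c) / (2 * π))) + c' : ℝ)) : AddCircle (2 * π)) := by
  have e : 2 * π * (f (Int.fract ((θ + c) / (2 * π))) + ((⌊(θ + c) / (2 * π)⌋ : ℤ) : ℝ)) + c' =
      (2 * π * f (Int.fract ((θ + c) / (2 * π))) + c') + (⌊(θ + c) / (2 * π)⌋ : ℤ) • (2 * π) := by
    rw [zsmul_eq_mul]
    ring
  rw [e, AddCircle.coe_add, AddCircle.coe_zsmul, AddCircle.coe_period, smul_zero, add_zero]

/-- **Non-vacuity**: the circular-spline circle map and its Jacobian factor exist as functions on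
`ℝ/2πℤ` with the stated values on representatives (the lift descends). -/
theorem exists_circle_circSpline
    (hderiv : ∀ u ∈ Icc (0 : ℝ) 1, HasDerivWithinAt f (f' u) (Icc 0 1) u)
    (hdeg : f 1 = f 0 + 1) (hslope : f' 1 = f' 0) (c c' : ℝ) :
    ∃ (F : AddCircle (2 * π) → AddCircle (2 * π)) (J : AddCircle (2 * π) → ℝ≥0∞),
      (∀ θ : ℝ, F θ = (((2 * π * f (Int.fract ((θ + c) / (2 * π))) + c' : ℝ)) : AddCircle (2 * π)))
      ∧ ∀ θ : ℝ, J θ = ENNReal.ofReal (f' (Int.fract ((θ + c) / (2 * π)))) := by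
  obtain ⟨F, j, hF, hj⟩ := exists_circle_lift_of_degreeOne
    (Φ := fun t : ℝ => 2 * π * (f (Int.fract ((t + c) / (2 * π))) +
      ((⌊(t + c) / (2 * π)⌋ : ℤ) : ℝ)) + c')
    (Φ' := fun θ : ℝ => f' (Int.fract ((θ + c) / (2 * π))))
    (fun θ => hasDerivAt_circSplineLift hderiv hdeg hslope c c' θ)
    (fun θ => circSplineLift_add_two_pi f c c' θ)
  refine ⟨F, fun x => ENNReal.ofReal (j x), fun θ => ?_, fun θ => by simp only [hj]⟩
  rw [hF, circSplineLift_coe]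

variable [hT : Fact (0 < 2 * π)]

/-- **Circular splines are certified circle maps.**  Let the unit-interval profile `f` be `C¹` on
`[0,1]` (one-sided at the ends) with continuous positive derivative `f'`, `f 1 = f 0 + 1` and
equal end slopes `f' 1 = f' 0`.  Then for any shifts `c`, `c'`, any `F : ℝ/2πℤ → ℝ/2πℤ` with
`F ↑θ = ↑(2π·f(fract((θ + c)/(2π))) + c')` and any `J` with
`J ↑θ = ofReal (f'(fract((θ + c)/(2π))))` satisfy `HasJacobian volume F J`: the Haar measure of the
link pushed through the circular-spline layer, weighted by the engine's Jacobian, is the Haar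
measure.  (`c = π − σ_in`, `c' = σ_in + σ_out − π` is `circ_spline_forward`.) -/
theorem hasJacobian_circle_circSpline
    (hderiv : ∀ u ∈ Icc (0 : ℝ) 1, HasDerivWithinAt f (f' u) (Icc 0 1) u)
    (hcont : ContinuousOn f' (Icc 0 1)) (hpos : ∀ u ∈ Icc (0 : ℝ) 1, 0 < f' u)
    (hdeg : f 1 = f 0 + 1) (hslope : f' 1 = f' 0) (c c' : ℝ)
    {F : AddCircle (2 * π) → AddCircle (2 * π)}
    (hF : ∀ θ : ℝ, F θ = (((2 * π * f (Int.fract ((θ + c) / (2 * π))) + c' : ℝ)) : AddCircle (2 * π)))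
    {J : AddCircle (2 * π) → ℝ≥0∞}
    (hJ : ∀ θ : ℝ, J θ = ENNReal.ofReal (f' (Int.fract ((θ + c) / (2 * π))))) :
    HasJacobian (volume : Measure (AddCircle (2 * π))) F J := by
  have hcontΦ' : Continuous fun θ : ℝ => f' (Int.fract ((θ + c) / (2 * π))) :=
    (continuous_unitExt_deriv hcont hslope).comp ((continuous_id.add continuous_const).div_const _)
  refine hasJacobian_circle_of_degreeOne
    (Φ := fun t : ℝ => 2 * π * (f (Int.fract ((t + c) / (2 * π))) +
      ((⌊(t + c) / (2 * π)⌋ : ℤ) : ℝ)) + c')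
    (Φ' := fun θ : ℝ => f' (Int.fract ((θ + c) / (2 * π))))
    (fun θ => hasDerivAt_circSplineLift hderiv hdeg hslope c c' θ) hcontΦ'
    (fun θ => unitExt_deriv_pos hpos _) (fun θ => circSplineLift_add_two_pi f c c' θ)
    (fun θ => ?_) hJ
  rw [hF θ, circSplineLift_coe]

end Circle

end Summit.Ventures.LatticeQCDFlow.Exactness
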